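import Mathlib
import HarnessLib
import Summits.HubbardSuperconductivity.HubbardSuperconductivity.Theorems.KLProgrammeKLRegimeBetaSplitExtra
import Summits.HubbardSuperconductivity.HubbardSuperconductivity.Theorems.KLProgrammeKLRegimeSplitBundleV8

/-!
# Route `KLProgramme` — crux K3, child 1 at SLOT level for the gen-3 engine slot: `BetaSplitP Pr W` for EVERY bundle whose split slot is implied by
# `BetaSplitAtS2` and whose engine slot implies `EngineBoundsAtV6S` (V8, V9 = V8 + (E3g), and any later two-leg/renorm/frameOK re-staging)

Cell gate-hubbard-kl, seat hubbard-kl-k3c1-p2 (child-1 re-closure owner on gen 3).  `betaSplitP_klPredsV8` (`…KLRegimeBetaSplitV8`, p458060) closed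
child 1 at the V8 bundle; plan g10's Δ18 ruling (17:26Z) re-bases the gen-3 resplit on `klPredsV9 := { klPredsV8 with twoLeg := TwoLegStepV9 }` —
split and engine slots UNTOUCHED.  Child 1 reads only those two slots, so here the V8 proof is stated once SLOT-GENERICALLY (r2d-p1's
`betaSplitP_of_slotsS2` pattern, one engine version up): **`betaSplitP_of_slotsV6S`** — hypotheses `BetaSplitAtS2 … → Pr.split …` and
`Pr.engine … → EngineBoundsAtV6S …`; proof = `betaSplitP_of_extraClauses` (`…KLRegimeBetaSplitExtra`) at `𝔛 = thermalBar + legDressBarQ·legSliceCountT`,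
numerals `(1, 8, 4/3, 40)`.  Every bundle `klPredsVn` with these two slots closes child 1 by `betaSplitP_of_slotsV6S (fun … h => h) (fun … h => h)`.
Everything is proved; no definitions.
-/

noncomputable section

namespace Summit.HubbardSuperconductivity.HubbardSuperconductivity.Theorems.KLRegimeSplit

set_option linter.dupNamespace false -- summit = problem name (single-conjunct summit), D-0017

open Real Finset Literature.MathematicalPhysics.QuantumLattice Literature.Probability.LatticeModels
open Summit.HubbardSuperconductivity.HubbardSuperconductivity.Theorems.KLProgrammeLegKernels
open Summit.HubbardSuperconductivity.HubbardSuperconductivity.Theorems.CooperChannelRiccatiFlow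
open Summit.HubbardSuperconductivity.HubbardSuperconductivity.Theorems.DispersionFlow

/-- **Child 1 at slot level for the V6S engine slot, every bundle and window.**  If `BetaSplitAtS2 ⇒ Pr.split` and
`Pr.engine ⇒ EngineBoundsAtV6S` (for `klPredsV8`, `klPredsV9`, … by `rfl`), then `BetaSplitP Pr W`. -/
theorem betaSplitP_of_slotsV6S {Pr : Preds} {W : Set ℝ}
    (hs : ∀ (L M : ℕ) [NeZero L] [NeZero M] (G : GeoConsts) (P : SplitConsts) (Q : EngConsts) (β U μ : ℝ) (K : TrigPolyC4v) (n : ℕ),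
      BetaSplitAtS2 L M G P Q β U μ K n → Pr.split L M G P Q β U μ K n)
    (he : ∀ (L M : ℕ) [NeZero L] [NeZero M] (G : GeoConsts) (P : SplitConsts) (Q : EngConsts) (β U μ : ℝ) (K : TrigPolyC4v) (n : ℕ),
      Pr.engine L M G P Q β U μ K n → EngineBoundsAtV6S L M G P Q β U μ K n) :
    BetaSplitP Pr W := by
  refine betaSplitP_of_extraClauses (Pr := Pr) (sG := 1) (sQ := 8) (tG := 4 / 3) (tQ := 40) zero_le_one (by norm_num)
    (by norm_num) (by norm_num) (by unfold klLegKappa; norm_num)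
    (fun L G P Q β U μ K j Qm k k' => thermalBar G P U β j + legDressBarQ G P Q U j (legSliceCountT L β μ K j ![k', Qm - k', Qm - k, k]))
    ?_ ?_ ?_ ?_ hs ?_
  · -- nonnegativity
    intro L G P Q β U μ K j Qm k k' hG hP hQ
    have hCF : 0 ≤ G.CF := hG.2.2.2.2.2.2.2.2.2.2.2.2.2.1
    exact add_nonneg (thermalBar_nonneg hCF P U β j) (legDressBarQ_nonneg G (zero_le_one.trans hP.1) hQ.2.1 U j _)
  · -- per-scale size: `thermalBar ≤ CF(Klam U)²`, `legDressBarQ·count ≤ 2·CR·Klam³·U²·4`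
    intro L G P Q β U μ K j Qm k k' hG hP hQ hU hU1
    have hCF : 0 ≤ G.CF := hG.2.2.2.2.2.2.2.2.2.2.2.2.2.1
    have hK0 : 0 ≤ P.Klam := zero_le_one.trans hP.1
    have hCR : 0 ≤ Q.CR := hQ.2.1
    have h1 := thermalBar_le hCF P U β j
    have h2 := legDressBarQ_le G hK0 hCR U j (legSliceCountT L β μ K j ![k', Qm - k', Qm - k, k])
    have hcr3 := cr3_le hP.1 hCR hU1
    have h4 : (legSliceCountT L β μ K j ![k', Qm - k', Qm - k, k] : ℝ) ≤ 4 := by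
      exact_mod_cast legSliceCountT_le_four L β μ K j _
    have hq30 : 0 ≤ Q.CR * P.Klam ^ 3 * U ^ 2 := by positivity
    have h3 : Q.CR * ((P.Klam * U) ^ 2 + (P.Klam * |U|) ^ 3) * (legSliceCountT L β μ K j ![k', Qm - k', Qm - k, k] : ℝ) ≤
        2 * Q.CR * P.Klam ^ 3 * U ^ 2 * 4 := mul_le_mul hcr3 h4 (Nat.cast_nonneg _) (by positivity)
    linarith
  · -- scale sums over `(t, n]`
    intro L G P Q β U μ K t n Qm k k' hG hP hQ hU hU1 hn
    have hCF : 0 ≤ G.CF := hG.2.2.2.2.2.2.2.2.2.2.2.2.2.1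
    have hK0 : 0 ≤ P.Klam := zero_le_one.trans hP.1
    have hcr3 := cr3_le hP.1 hQ.2.1 hU1
    have hsub : ∀ (f : ℕ → ℝ), (∀ j, 0 ≤ f j) → ∑ j ∈ Ioc t n, f j ≤ ∑ j ∈ range (n + 1), f j := fun f hf =>
      sum_le_sum_of_subset_of_nonneg (fun j hj => by simp only [mem_Ioc] at hj; exact mem_range.2 (by omega)) fun j _ _ => hf j
    have h1 : ∑ j ∈ Ioc t n, thermalBar G P U β j ≤ 4 / 3 * (G.CF * (P.Klam * U) ^ 2) :=
      (hsub _ fun j => thermalBar_nonneg hCF P U β j).trans (thermalBar_sum_le hCF P U β hn)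
    have h2 : ∑ j ∈ Ioc t n, legDressBarQ G P Q U j (legSliceCountT L β μ K j ![k', Qm - k', Qm - k, k]) ≤
        20 * (2 * Q.CR * P.Klam ^ 3 * U ^ 2) :=
      ((hsub _ fun j => legDressBarQ_nonneg G hK0 hQ.2.1 U j _).trans
          (legDressBarQ_countT_sum_le L G hK0 hQ.2.1 U β μ K _ n)).trans (by nlinarith [hcr3])
    rw [sum_add_distrib]
    linarith
  · -- scale sums over `i < n` of the `(i+1)`-terms
    intro L G P Q β U μ K n Qm k k' hG hP hQ hU hU1 hn
    have hCF : 0 ≤ G.CF := hG.2.2.2.2.2.2.2.2.2.2.2.2.2.1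
    have hK0 : 0 ≤ P.Klam := zero_le_one.trans hP.1
    have hcr3 := cr3_le hP.1 hQ.2.1 hU1
    have h1 : ∑ i ∈ range n, thermalBar G P U β (i + 1) ≤ 4 / 3 * (G.CF * (P.Klam * U) ^ 2) :=
      (sum_range_succ_shift_le (f := fun m => thermalBar G P U β m) (fun m => thermalBar_nonneg hCF P U β m) n).trans
        (thermalBar_sum_le hCF P U β hn)
    have h2 : ∑ i ∈ range n, legDressBarQ G P Q U (i + 1) (legSliceCountT L β μ K (i + 1) ![k', Qm - k', Qm - k, k]) ≤
        20 * (2 * Q.CR * P.Klam ^ 3 * U ^ 2) :=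
      ((sum_range_succ_shift_le (f := fun m => legDressBarQ G P Q U m (legSliceCountT L β μ K m ![k', Qm - k', Qm - k, k]))
          (fun m => legDressBarQ_nonneg G hK0 hQ.2.1 U m _) n).trans
          (legDressBarQ_countT_sum_le L G hK0 hQ.2.1 U β μ K _ n)).trans (by nlinarith [hcr3])
    rw [sum_add_distrib]
    linarith
  · -- the engine slot yields `EngineBoundsAtV6S`: project the four clauses child 1 reads, re-associating the remainder
    intro L M _ _ G P Q β U μ K n h
    have h' : EngineBoundsAtV6S L M G P Q β U μ K n := he L M G P Q β U μ K n h
    refine ⟨fun hn0 => h'.2.2.1.1 hn0, fun hn1 Qm hQ => ?_, fun hn1 Qm k hk k' hk' => ?_, h'.2.2.2.2.2.2.1, h'.2.2.2.2.2.2.2⟩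
    · obtain ⟨w, hw0, hws, N, hN, hb⟩ := h'.2.2.1.2 hn1 Qm hQ
      exact ⟨w, hw0, hws, N, hN, fun k hk k' hk' => (hb k hk k' hk').trans (le_of_eq (by ring))⟩
    · exact (h'.2.2.2.1 hn1 Qm k hk k' hk').trans (le_of_eq (by ring))

end Summit.HubbardSuperconductivity.HubbardSuperconductivity.Theorems.KLRegimeSplit

end
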